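import Mathlib

/-!
# Homogeneous components of `det(D + Z)` for a `0/1` diagonal `D`: principal-minor expansion

Route `ValiantsHypothesis/BorderApolarity`, crux `ToricWitnessObstructionQP`
(stmt-ValiantsHypothesis-14753), line `Sketch`, lead c5 — third helper for the regime analysis of
torus leading forms of `per₃` below Grenet's size `7` (crux work note `regimes.md`, §3 step (i)):
the corank branches of the jet regime.  If the constant part of an affine matrix pencil has been
brought to a `0/1` diagonal matrix `D` (zeros on `S₀`), the degree-`k` part of `det(D + Z(y))`
(`Z` linear) is the sum of the principal `k × k` minors of `Z` whose index set contains `S₀`: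

* `homogeneousComponent_det_diagonal_add`:
  `(det (D + Z))_k = Σ_{S₀ ⊆ A, |A| = k} det Z[A, A]`.

In particular there are no terms of degree `< |S₀|` (`homogeneousComponent_det_eq_zero_of_lt`)
and the degree-`|S₀|` part is the single minor `det Z[S₀, S₀]`
(`homogeneousComponent_det_card`).  Proof: Leibniz, `Π (c_i + z_i) = Σ_A Π_A z Π_{Aᶜ} c`
(`Finset.prod_add`), the constant factor survives iff the permutation fixes `Aᶜ ⊆ S₀ᶜ`
pointwise, and permutations fixing `Aᶜ` are the permutations of `A`
(`Equiv.Perm.subtypeEquivSubtypePerm`).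
-/

open MvPolynomial Matrix Finset

-- the mandated summit-side namespace repeats a component by design (single-problem summit)
set_option linter.dupNamespace false

namespace Summit.ValiantsHypothesis.ValiantsHypothesis.Theorems.BorderApolarityToricWitnessObstructionQP

noncomputable section

namespace PrincipalMinors

variable {K : Type*} [Field K] {σ : Type*} {m : ℕ}

/-- Sum over the permutations fixing the complement of `A` pointwise of the `A`-part of the
Leibniz term = the principal minor on `A`. [folklore] -/
theorem sum_perm_fixing_eq_det {R : Type*} [CommRing R] (A : Finset (Fin m))
    (Z : Matrix (Fin m) (Fin m) R) :
    ∑ σ ∈ (Finset.univ : Finset (Equiv.Perm (Fin m))) with (∀ i, i ∉ A → σ i = i),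
        ((Equiv.Perm.sign σ : ℤ) : R) * ∏ i ∈ A, Z (σ i) i =
      (Z.submatrix (fun a : A => (a : Fin m)) (fun a : A => (a : Fin m))).det := by
  classical
  have h1 : ∑ σ ∈ (Finset.univ : Finset (Equiv.Perm (Fin m))) with (∀ i, i ∉ A → σ i = i),
        ((Equiv.Perm.sign σ : ℤ) : R) * ∏ i ∈ A, Z (σ i) i =
      ∑ x : {σ : Equiv.Perm (Fin m) // ∀ i, i ∉ A → σ i = i},
        ((Equiv.Perm.sign x.1 : ℤ) : R) * ∏ i ∈ A, Z (x.1 i) i :=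
    Finset.sum_subtype _ (fun σ => by simp) _
  rw [h1, ← (Equiv.Perm.subtypeEquivSubtypePerm (· ∈ A)).sum_comp, Matrix.det_apply']
  refine Finset.sum_congr rfl fun τ _ => ?_
  have he : ((Equiv.Perm.subtypeEquivSubtypePerm (· ∈ A)) τ).1 = Equiv.Perm.ofSubtype τ := rfl
  rw [he, Equiv.Perm.sign_ofSubtype, ← Finset.prod_coe_sort A]
  simp only [Equiv.Perm.ofSubtype_apply_coe, Matrix.submatrix_apply]

/-- **Principal-minor expansion.**  For a `0/1` diagonal `D` (zeros exactly on `S₀`) and a matrix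
`Z` of linear forms, the degree-`k` homogeneous component of `det (D + Z)` is the sum of the
principal minors `det Z[A,A]` over the `k`-sets `A ⊇ S₀`. [folklore] -/
theorem homogeneousComponent_det_diagonal_add (S₀ : Finset (Fin m))
    (Z : Matrix (Fin m) (Fin m) (MvPolynomial σ K)) (hZ : ∀ i j, (Z i j).IsHomogeneous 1) (k : ℕ) :
    homogeneousComponent k
        ((Matrix.diagonal fun i => if i ∈ S₀ then (0 : MvPolynomial σ K) else 1) + Z).det =
      ∑ A ∈ (Finset.univ : Finset (Fin m)).powerset with (S₀ ⊆ A ∧ A.card = k),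
        (Z.submatrix (fun a : A => (a : Fin m)) (fun a : A => (a : Fin m))).det := by
  classical
  set D : Matrix (Fin m) (Fin m) (MvPolynomial σ K) :=
    Matrix.diagonal fun i => if i ∈ S₀ then (0 : MvPolynomial σ K) else 1 with hD
  -- Leibniz and the expansion of each product
  have hentry : ∀ (τ : Equiv.Perm (Fin m)) (i : Fin m), (D + Z) (τ i) i =
      Z (τ i) i + (if τ i = i ∧ i ∉ S₀ then 1 else 0) := by
    intro τ i
    rw [Matrix.add_apply, hD, Matrix.diagonal_apply, add_comm]
    congr 1
    by_cases h : τ i = i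
    · rw [if_pos h, h]
      by_cases h' : i ∈ S₀
      · rw [if_pos h', if_neg (fun hh => hh.2 h')]
      · rw [if_neg h', if_pos ⟨rfl, h'⟩]
    · rw [if_neg h, if_neg (fun hh => h hh.1)]
  have hprod : ∀ τ : Equiv.Perm (Fin m), ∏ i, (D + Z) (τ i) i =
      ∑ A ∈ (Finset.univ : Finset (Fin m)).powerset,
        (∏ i ∈ A, Z (τ i) i) * (if (∀ i, i ∉ A → (τ i = i ∧ i ∉ S₀)) then 1 else 0) := by
    intro τ
    simp_rw [hentry]
    rw [Finset.prod_add]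
    refine Finset.sum_congr rfl fun A _ => ?_
    congr 1
    rw [Finset.prod_boole]
    by_cases h : ∀ i, i ∉ A → (τ i = i ∧ i ∉ S₀)
    · rw [if_pos h, if_pos]
      intro i hi
      exact h i (Finset.mem_sdiff.1 hi).2
    · rw [if_neg h, if_neg]
      intro h'
      exact h fun i hi => h' i (Finset.mem_sdiff.2 ⟨Finset.mem_univ i, hi⟩)
  -- homogeneous components of the Leibniz terms
  have hhom : ∀ (τ : Equiv.Perm (Fin m)) (A : Finset (Fin m)),
      (∏ i ∈ A, Z (τ i) i).IsHomogeneous A.card := by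
    intro τ A
    have h := IsHomogeneous.prod A (fun i => Z (τ i) i) (fun _ => 1) fun i _ => hZ (τ i) i
    rwa [Finset.sum_const, smul_eq_mul, mul_one] at h
  have hcomp : ∀ (τ : Equiv.Perm (Fin m)) (A : Finset (Fin m)),
      homogeneousComponent k ((∏ i ∈ A, Z (τ i) i) *
          (if (∀ i, i ∉ A → (τ i = i ∧ i ∉ S₀)) then 1 else 0)) =
        if (A.card = k ∧ ∀ i, i ∉ A → (τ i = i ∧ i ∉ S₀)) then ∏ i ∈ A, Z (τ i) i else 0 := by
    intro τ A
    by_cases h : ∀ i, i ∉ A → (τ i = i ∧ i ∉ S₀)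
    · rw [if_pos h, mul_one, homogeneousComponent_of_mem (hhom τ A)]
      by_cases hk : A.card = k
      · rw [if_pos hk.symm, if_pos ⟨hk, h⟩]
      · rw [if_neg (Ne.symm hk), if_neg (fun hh => hk hh.1)]
    · rw [if_neg h, mul_zero, map_zero, if_neg (fun hh => h hh.2)]
  -- assemble
  rw [Matrix.det_apply', map_sum]
  have hterm : ∀ τ : Equiv.Perm (Fin m),
      homogeneousComponent k (((Equiv.Perm.sign τ : ℤ) : MvPolynomial σ K) * ∏ i, (D + Z) (τ i) i) =
        ∑ A ∈ (Finset.univ : Finset (Fin m)).powerset,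
          if (A.card = k ∧ ∀ i, i ∉ A → (τ i = i ∧ i ∉ S₀)) then
            ((Equiv.Perm.sign τ : ℤ) : MvPolynomial σ K) * ∏ i ∈ A, Z (τ i) i else 0 := by
    intro τ
    have hC : ((Equiv.Perm.sign τ : ℤ) : MvPolynomial σ K) = C ((Equiv.Perm.sign τ : ℤ) : K) := by
      rw [← map_intCast (C : K →+* MvPolynomial σ K)]
    rw [hprod τ, Finset.mul_sum, map_sum]
    refine Finset.sum_congr rfl fun A _ => ?_
    rw [hC, homogeneousComponent_C_mul, hcomp]
    split_ifs <;> simp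
  simp_rw [hterm]
  rw [Finset.sum_comm]
  -- restrict the outer sum to the `k`-sets containing `S₀`
  rw [← Finset.sum_filter_add_sum_filter_not (Finset.univ.powerset) (fun A => S₀ ⊆ A ∧ A.card = k)]
  have hzero : ∑ A ∈ (Finset.univ : Finset (Fin m)).powerset with ¬(S₀ ⊆ A ∧ A.card = k),
      ∑ τ : Equiv.Perm (Fin m),
        (if (A.card = k ∧ ∀ i, i ∉ A → (τ i = i ∧ i ∉ S₀)) then
          ((Equiv.Perm.sign τ : ℤ) : MvPolynomial σ K) * ∏ i ∈ A, Z (τ i) i else 0) = 0 := by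
    refine Finset.sum_eq_zero fun A hA => Finset.sum_eq_zero fun τ _ => ?_
    rw [Finset.mem_filter] at hA
    rw [if_neg]
    rintro ⟨hk, h⟩
    refine hA.2 ⟨fun i hi => ?_, hk⟩
    by_contra hiA
    exact (h i hiA).2 hi
  rw [hzero, add_zero]
  refine Finset.sum_congr rfl fun A hA => ?_
  rw [Finset.mem_filter] at hA
  obtain ⟨-, hS₀A, hk⟩ := hA
  -- inner sum: only permutations fixing `Aᶜ` contribute, and they give the minor
  rw [← sum_perm_fixing_eq_det A Z, Finset.sum_filter]
  refine Finset.sum_congr rfl fun τ _ => ?_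
  by_cases h : ∀ i, i ∉ A → τ i = i
  · rw [if_pos h, if_pos]
    exact ⟨hk, fun i hi => ⟨h i hi, fun hiS => hi (hS₀A hiS)⟩⟩
  · rw [if_neg h, if_neg]
    exact fun hh => h fun i hi => (hh.2 i hi).1

/-- Below the corank there are no terms: `(det (D + Z))_k = 0` for `k < |S₀|`. [folklore] -/
theorem homogeneousComponent_det_eq_zero_of_lt (S₀ : Finset (Fin m))
    (Z : Matrix (Fin m) (Fin m) (MvPolynomial σ K)) (hZ : ∀ i j, (Z i j).IsHomogeneous 1) {k : ℕ}
    (hk : k < S₀.card) :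
    homogeneousComponent k
        ((Matrix.diagonal fun i => if i ∈ S₀ then (0 : MvPolynomial σ K) else 1) + Z).det = 0 := by
  classical
  rw [homogeneousComponent_det_diagonal_add S₀ Z hZ k]
  refine Finset.sum_eq_zero fun A hA => ?_
  rw [Finset.mem_filter] at hA
  have := Finset.card_le_card hA.2.1
  omega

/-- At the corank the only term is the principal minor on `S₀`:
`(det (D + Z))_{|S₀|} = det Z[S₀, S₀]`. [folklore] -/
theorem homogeneousComponent_det_card (S₀ : Finset (Fin m))
    (Z : Matrix (Fin m) (Fin m) (MvPolynomial σ K)) (hZ : ∀ i j, (Z i j).IsHomogeneous 1) :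
    homogeneousComponent S₀.card
        ((Matrix.diagonal fun i => if i ∈ S₀ then (0 : MvPolynomial σ K) else 1) + Z).det =
      (Z.submatrix (fun a : S₀ => (a : Fin m)) (fun a : S₀ => (a : Fin m))).det := by
  classical
  rw [homogeneousComponent_det_diagonal_add S₀ Z hZ S₀.card]
  have hfilter : ((Finset.univ : Finset (Fin m)).powerset.filter fun A => S₀ ⊆ A ∧ A.card = S₀.card) =
      {S₀} := by
    ext A
    simp only [Finset.mem_filter, Finset.mem_powerset, Finset.subset_univ, true_and,
      Finset.mem_singleton]
    constructor
    · rintro ⟨h1, h2⟩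
      exact (Finset.eq_of_subset_of_card_le h1 h2.le).symm
    · rintro rfl
      exact ⟨le_rfl, rfl⟩
  rw [hfilter, Finset.sum_singleton]

end PrincipalMinors

/-- **Principal-minor expansion of `det (D + Z)`** (registered helper form of
`PrincipalMinors.homogeneousComponent_det_diagonal_add`): for a `0/1` diagonal `D` with zeros on
`S₀` and a matrix `Z` of linear forms, the degree-`k` component of `det (D + Z)` is the sum of the
principal minors of `Z` on the `k`-sets containing `S₀`. [folklore] -/
theorem principalMinorExpansion_det : ∀ {K : Type*} [Field K] {σ : Type*} {m : ℕ} (S₀ : Finset (Fin m)) (Z : Matrix (Fin m) (Fin m) (MvPolynomial σ K)), (∀ i j, (Z i j).IsHomogeneous 1) → ∀ (k : ℕ), MvPolynomial.homogeneousComponent k ((Matrix.diagonal fun i => if i ∈ S₀ then (0 : MvPolynomial σ K) else 1) + Z).det = ∑ A ∈ (Finset.univ : Finset (Fin m)).powerset with (S₀ ⊆ A ∧ A.card = k), (Z.submatrix (fun a : A => (a : Fin m)) (fun a : A => (a : Fin m))).det :=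
  fun S₀ Z hZ k => PrincipalMinors.homogeneousComponent_det_diagonal_add S₀ Z hZ k

end

end Summit.ValiantsHypothesis.ValiantsHypothesis.Theorems.BorderApolarityToricWitnessObstructionQP
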